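/-
Copyright: the b2b-balaban T⁴-continuum CRUX team, row NE7b leaf lineage `t4-ne7b-formalise-leaf-06` (gen 161). Project licence.
-/
import Summits.QuantumFields.BalabanUV.T4Continuum.Spine.NE7b.SupInductiveStep

/-!
# THE EQUATION-MAP TOWER's RE-ENTRANT STEP OVER ℕ: a TYPE FAMILY `X k` of field spaces, blockings `Q_k : X k → X (k+1)`, and at
# level `k` an equation map `Eq` whose linearisation at `0` is the TRANSPORTED one, `Eq′(0) = 𝒬_k ∘ A₀ ∘ 𝒮` for an ADMISSIBLE
# linear section `𝒮` of the composite blocking `𝒬_k = Q_{k−1}∘⋯∘Q_0` ⟹ `…SupInductiveStep.inductiveStep_eq` applies with the chart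
# read on `(Q_k, P_k∘𝒬_k∘A₀∘𝒮)` and smallness `C_{P_k}·M_k·r_k ≤ c_k`, AND the next equation map `Q_k∘Eq∘σ_k` with the next section
# `𝒮∘Dσ_k(0)` is again such a state at level `k+1` — the invariant that lets the tower run over ℕ (row NE7b, node U5c; SIS BY NAME;
# [folklore]; any Banach currencies)

Cell `pub-balaban`, sub-cell `t4`, spine estimate NE7b (`T4WeightBudget.RelWeightBound`; the cell's OWN estimate — NOT PRINTED in
[Bałaban 1983–89], NOT PROVED).  Crux-route work under `Spine/NE7b/` by a row leaf (`t4-ne7b-formalise-leaf-06` gen 161) under FREEZE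
(0)'s crux-prover clause — the `ℕ`-indexed successor of this lineage's `…SupEquationTwoSteps` (STS, two levels); NOTHING of Bałaban's
is named as a Lean object, valued or asserted; no `T4Continuum/Support` leaf typed; no `def`; zero `sorry`.  Import: this lineage's
`…SupInductiveStep` (SIS) only.

WHY (located).  STS closes the induction IN SHAPE for two levels by reading the second chart in UNIVERSAL-SECTION form («for every
linear section `S` of `Q` killed by `P∘Eq′(0)`, `T₂ h = (Q₂ h, P₂(Q(Eq′(0)(S h))))`»).  Over ℕ the sections NEST: the level-`k`
linearisation at the origin is `Eq_k′(0) = Q_{k−1}∘Eq_{k−1}′(0)∘Dσ_{k−1}(0) = ⋯ = 𝒬_k ∘ Eq₀′(0) ∘ 𝒮_k` with `𝒮_k = Dσ_0(0)∘⋯∘Dσ_{k−1}(0)`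
the derivative of the composite transport, and `𝒮_k` is pinned by LINEAR conditions in user data alone: `𝒬_k∘𝒮_k = 1` and
`P_j∘𝒬_j∘Eq₀′(0)∘𝒮_k = 0` for every `j < k` (multi-level criticality of the linearised equation).  So the level-`k` chart is a
hypothesis on user data — «for every ADMISSIBLE `𝒮`, `T_k h = (Q_k h, P_k(𝒬_k(A₀(𝒮 h))))`», `A₀ := Eq₀′(0)` — and the state
«`Eq` is `C¹` on `closedBall 0 r_k` with letters `(B_k, M_k)`, `Eq 0 = 0`, `Eq′(0) = 𝒬_k∘A₀∘𝒮`, `𝒮` admissible» RE-ENTERS: SIS's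
next equation map `Q_k∘Eq∘σ_k` has `C¹` letters `‖Q_k‖B_kK₁` ∕ `‖Q_k‖(M_kK₁² + B_kK₁³C_{P_k}M_k)` on `ball 0 ρ_k` (`K₁ = (N_k⁻¹ − c_k)⁻¹`,
`ρ_k = (N_k⁻¹ − c_k)r_k`), hence on `closedBall 0 r_{k+1}` for any `r_{k+1} < ρ_k`; its linearisation at `0` is `Q_k∘Eq′(0)∘Dσ_k(0) =
𝒬_{k+1}∘A₀∘(𝒮∘Dσ_k(0))`, and `𝒮∘Dσ_k(0)` is admissible at level `k+1` by SIS (b) at `w = 0` (`Q_k∘Dσ_k(0) = 1`, `P_k(Eq′(0)(Dσ_k(0)v)) = 0`).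
The smallness SIS consumes is the modulus times the radius at EVERY level (`‖P_k∘(Eq′x − Eq′0)‖ ≤ C_{P_k}M_k‖x‖ ≤ C_{P_k}M_kr_k ≤ c_k`),
so every chart inverts the TRUE linearisation at the current background (the OWNER's (61) road supplies such charts in the instance).
HONEST BOOKKEEPING (the pricing desk's located note on STS, v132 F784): nothing here is small by itself — `K₁ > 1` whenever `N_k > 1`,
the radii shrink (`r_{k+1} < (N_k⁻¹ − c_k)r_k`), the moduli grow by `‖Q_k‖K₁²(1 + B_kK₁C_{P_k})`; the letters are DISPLAYED recursions,
their control (rescaling ∕ kernel decay ∕ (A3)) is the junction not typed here.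

WHAT IS PROVED ([folklore]; `X, K : ℕ → Type`, every `X k` a nontrivial real Banach space, every `K k` real normed):
* §1 `norm_comp_sub_le_of_modulus_closedBall` (`‖P∘(Y x − Y 0)‖ ≤ C·M·r` on `closedBall 0 r` from a two-point modulus there),
  `comp_section_apply` (`𝒬∘𝒮 = 1`, `Q∘D = 1` ⟹ `Q(𝒬(𝒮(D v))) = v`).
* §2 **`towerStep`** — the tower's data as `ℕ`-indexed families (blockings `(Q, Lp, P, ι)` with `ι_k(P_k h) = h − Lp_k(Q_k h)`,
  `‖P_k‖ ≤ C_{P_k}`, composite blockings `𝒬_{k+1} = Q_k∘𝒬_k`, charts `T_k` in the admissible-section form above with `‖T_k⁻¹ y‖ ≤ N_k‖y‖`,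
  numbers `c_k < N_k⁻¹`, `C_{P_k}M_kr_k ≤ c_k`, radii `0 ≤ r_k`, `r_{k+1} < (N_k⁻¹ − c_k)r_k`, and the two recursion inequalities for
  `B_{k+1}`, `M_{k+1}`) and a STATE at level `k` (`Eq, Eq′, 𝒮` as in WHY) ⟹ `∃ σ : X (k+1) → X k`, `σ 0 = 0`, with SIS's branch letters
  (a) on `closedBall 0 ρ_k` (ball membership, `Q_k(σ w) = w`, `P_k(Eq(σ w)) = 0`, the lift identity, `K₁`-Lipschitz, uniqueness), (b) on
  `ball 0 ρ_k` (`σ` differentiable, `‖Dσ‖ ≤ K₁`, `Q_k∘Dσ = 1`), (d) zeros lift `Q_k(Eq(σ w)) = 0 → Eq(σ w) = 0`, AND THE NEXT STATE: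
  `Q_k(Eq(σ 0)) = 0`; on `closedBall 0 r_{k+1}`: `HasFDerivAt (Q_k∘Eq∘σ) (Q_k∘Eq′(σ w)∘Dσ(w)) w`, bound `B_{k+1}`, modulus `M_{k+1}`;
  `𝒬_{k+1}∘(𝒮∘Dσ(0)) = 1`; admissibility of `𝒮∘Dσ(0)` for every `j < k+1`; `Q_k∘Eq′(σ 0)∘Dσ(0) = 𝒬_{k+1}∘A₀∘(𝒮∘Dσ(0))`.
* §3 toy: at level `0` the admissible sections of `𝒬_0 = 1` are `𝒮 = 1` only (`example`), so the level-`0` chart reads `(Q_0, P_0∘A₀)`.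

NOT HERE (honest): the recursion over ℕ itself and the composite transport `Φ_k = σ_0∘⋯∘σ_{k−1}` (the sibling `…SupEquationTower`);
charts `T_k`, `N_k` BY VALUE; any control of the displayed recursions; the `ℓ^∞(ℤ^d)` instance; (A3) ∕ (A1c); NC-NE7b-α UNRULED; anything
of Bałaban's.  BY-NAME EFFECT ON THE WALL: NONE.  NE7b NOT PRINTED ∕ NOT PROVED; spine PROVED 0∕9; rung (B)+1 on a FINITE torus — NOT
infinite volume, NOT the mass gap, NOT Clay.  HONEST DEPENDENCY: continuum YM on T⁴ ⇐ BetaPertH ∧ nine spine estimates (0∕9 proved);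
BetaPertH ⇐ (D1) ∧ (D4) ∧ CAP+tail; G-an2-4 gates asym, D1 and NE2∕3∕4.
-/

set_option autoImplicit false

noncomputable section

namespace Summit.QuantumFields.BalabanUV.T4Continuum.NE7b.SupEquationTowerStep

open Set Metric Function
open scoped NNReal
open Summit.QuantumFields.BalabanUV.T4Continuum.NE7b

/-! ## §1. Two small letters -/

section Letters

variable {E G H : Type*} [NormedAddCommGroup E] [NormedSpace ℝ E] [NormedAddCommGroup G] [NormedSpace ℝ G]
  [NormedAddCommGroup H] [NormedSpace ℝ H]

/-- The smallness letter from the modulus on a CLOSED ball: `‖Y x − Y x′‖ ≤ M‖x − x′‖` on `closedBall 0 r` and `‖P‖ ≤ C` give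
`‖P∘(Y x − Y 0)‖ ≤ C·M·r` there. [folklore] -/
theorem norm_comp_sub_le_of_modulus_closedBall {Y : E → E →L[ℝ] E} {r M C : ℝ} (P : E →L[ℝ] G) (hC : ‖P‖ ≤ C) (hM : 0 ≤ M)
    (hr : 0 ≤ r) (hY : ∀ x ∈ closedBall (0 : E) r, ∀ x' ∈ closedBall (0 : E) r, ‖Y x - Y x'‖ ≤ M * ‖x - x'‖)
    {x : E} (hx : x ∈ closedBall (0 : E) r) : ‖P.comp (Y x - Y 0)‖ ≤ C * M * r := by
  have h0 : (0 : E) ∈ closedBall (0 : E) r := mem_closedBall_self hr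
  have hxn : ‖x‖ ≤ r := by rwa [mem_closedBall, dist_zero_right] at hx
  have hC0 : 0 ≤ C := (norm_nonneg _).trans hC
  calc ‖P.comp (Y x - Y 0)‖ ≤ ‖P‖ * ‖Y x - Y 0‖ := ContinuousLinearMap.opNorm_comp_le _ _
    _ ≤ C * (M * ‖x - 0‖) := mul_le_mul hC (hY x hx 0 h0) (norm_nonneg _) hC0
    _ ≤ C * (M * r) := by rw [sub_zero]; exact mul_le_mul_of_nonneg_left (mul_le_mul_of_nonneg_left hxn hM) hC0
    _ = C * M * r := by ring

/-- Sections compose: `𝒬∘𝒮 = 1` and `Q∘D = 1` give `Q(𝒬(𝒮(D v))) = v`. [folklore] -/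
theorem comp_section_apply (𝒬 : E →L[ℝ] G) (𝒮 : G →L[ℝ] E) (Q : G →L[ℝ] H) (D : H →L[ℝ] G)
    (h𝒮 : 𝒬.comp 𝒮 = ContinuousLinearMap.id ℝ G) (hD : Q.comp D = ContinuousLinearMap.id ℝ H) (v : H) :
    Q (𝒬 (𝒮 (D v))) = v := by
  have e1 : 𝒬 (𝒮 (D v)) = D v := by simpa using congrArg (fun L : G →L[ℝ] G => L (D v)) h𝒮
  have e2 : Q (D v) = v := by simpa using congrArg (fun L : H →L[ℝ] H => L v) hD
  rw [e1, e2]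

end Letters

/-! ## §2. THE RE-ENTRANT STEP -/

variable {X : ℕ → Type*} {K : ℕ → Type*} [∀ k, NormedAddCommGroup (X k)] [∀ k, NormedSpace ℝ (X k)]
  [∀ k, NormedAddCommGroup (K k)] [∀ k, NormedSpace ℝ (K k)]

/-- **THE EQUATION-MAP TOWER's RE-ENTRANT STEP.**  Families over ℕ: blockings `Q_k, Lp_k, P_k, ι_k` (`ι_k(P_k h) = h − Lp_k(Q_k h)`,
`‖P_k‖ ≤ C_{P_k}`), composite blockings `𝒬_{k+1} = Q_k∘𝒬_k`, the fine linearisation `A₀`, charts `T_k` reading `(Q_k, P_k∘𝒬_k∘A₀∘𝒮)`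
for every admissible `𝒮` with `‖T_k⁻¹ y‖ ≤ N_k‖y‖`, numbers `c_k < N_k⁻¹`, `C_{P_k}M_kr_k ≤ c_k`, radii `0 ≤ r_k`, `r_{k+1} < (N_k⁻¹ − c_k)r_k`,
recursions `‖Q_k‖B_kK₁ ≤ B_{k+1}`, `‖Q_k‖(M_kK₁K₁ + B_k(K₁²(C_{P_k}M_k)K₁)) ≤ M_{k+1}`; a state `(Eq, Eq′, 𝒮)` at level `k` ⟹ the branch
`σ_k` with SIS's letters and the next state at level `k+1`. [folklore] -/
theorem towerStep [∀ k, CompleteSpace (X k)] [∀ k, Nontrivial (X k)]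
    (Q : ∀ k, X k →L[ℝ] X (k + 1)) (Lp : ∀ k, X (k + 1) →L[ℝ] X k) (P : ∀ k, X k →L[ℝ] K k) (ι : ∀ k, K k →L[ℝ] X k)
    (hPι : ∀ k h, ι k (P k h) = h - Lp k (Q k h)) {CP : ℕ → ℝ} (hCP : ∀ k, ‖P k‖ ≤ CP k)
    (𝒬 : ∀ k, X 0 →L[ℝ] X k) (h𝒬 : ∀ k, 𝒬 (k + 1) = (Q k).comp (𝒬 k)) (A₀ : X 0 →L[ℝ] X 0)
    {r B M : ℕ → ℝ} (hr0 : ∀ k, 0 ≤ r k) (hM0 : ∀ k, 0 ≤ M k)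
    (T : ∀ k, X k ≃L[ℝ] X (k + 1) × K k) {N c : ℕ → ℝ≥0}
    (hT : ∀ k (𝒮 : X k →L[ℝ] X 0), (𝒬 k).comp 𝒮 = ContinuousLinearMap.id ℝ (X k) →
      (∀ j, j < k → ∀ h, P j (𝒬 j (A₀ (𝒮 h))) = 0) → ∀ h, T k h = (Q k h, P k (𝒬 k (A₀ (𝒮 h)))))
    (hN : ∀ k (y : X (k + 1) × K k), ‖(T k).symm y‖ ≤ N k * ‖y‖) (hcN : ∀ k, c k < (N k)⁻¹)
    (hc : ∀ k, CP k * M k * r k ≤ (c k : ℝ)) (hr : ∀ k, r (k + 1) < ((N k : ℝ)⁻¹ - c k) * r k)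
    (hBs : ∀ k, ‖Q k‖ * B k * ((N k : ℝ)⁻¹ - c k)⁻¹ ≤ B (k + 1))
    (hMs : ∀ k, ‖Q k‖ * (M k * ((N k : ℝ)⁻¹ - c k)⁻¹ * ((N k : ℝ)⁻¹ - c k)⁻¹ +
      B k * ((((N k : ℝ)⁻¹ - c k)⁻¹) ^ 2 * (CP k * M k) * ((N k : ℝ)⁻¹ - c k)⁻¹)) ≤ M (k + 1))
    -- the state at level `k`
    (k : ℕ) {Eq : X k → X k} {Eq' : X k → X k →L[ℝ] X k} {𝒮 : X k →L[ℝ] X 0}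
    (hE0 : Eq 0 = 0) (hE : ∀ x ∈ closedBall (0 : X k) (r k), HasFDerivAt Eq (Eq' x) x)
    (hB : ∀ x ∈ closedBall (0 : X k) (r k), ‖Eq' x‖ ≤ B k)
    (hM : ∀ x ∈ closedBall (0 : X k) (r k), ∀ x' ∈ closedBall (0 : X k) (r k), ‖Eq' x - Eq' x'‖ ≤ M k * ‖x - x'‖)
    (h𝒮 : (𝒬 k).comp 𝒮 = ContinuousLinearMap.id ℝ (X k))
    (hadm : ∀ j, j < k → ∀ h, P j (𝒬 j (A₀ (𝒮 h))) = 0)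
    (hlin : Eq' 0 = (𝒬 k).comp (A₀.comp 𝒮)) :
    ∃ σ : X (k + 1) → X k, σ 0 = 0 ∧
      -- (a) the branch on the closed chart ball
      (∀ w ∈ closedBall (0 : X (k + 1)) (((N k : ℝ)⁻¹ - c k) * r k),
        σ w ∈ closedBall (0 : X k) (r k) ∧ Q k (σ w) = w ∧ P k (Eq (σ w)) = 0 ∧ Eq (σ w) = Lp k (Q k (Eq (σ w)))) ∧
      LipschitzOnWith ((N k)⁻¹ - c k)⁻¹ σ (closedBall (0 : X (k + 1)) (((N k : ℝ)⁻¹ - c k) * r k)) ∧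
      (∀ x ∈ closedBall (0 : X k) (r k), P k (Eq x) = 0 → σ (Q k x) = x) ∧
      -- (b) the derivative letters on the open chart ball
      (∀ w ∈ ball (0 : X (k + 1)) (((N k : ℝ)⁻¹ - c k) * r k), DifferentiableAt ℝ σ w ∧
        ‖fderiv ℝ σ w‖ ≤ ((N k : ℝ)⁻¹ - c k)⁻¹ ∧ (Q k).comp (fderiv ℝ σ w) = ContinuousLinearMap.id ℝ (X (k + 1))) ∧
      -- (d) zeros of the next equation lift
      (∀ w ∈ closedBall (0 : X (k + 1)) (((N k : ℝ)⁻¹ - c k) * r k), Q k (Eq (σ w)) = 0 → Eq (σ w) = 0) ∧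
      -- THE NEXT STATE at level `k + 1`
      Q k (Eq (σ 0)) = 0 ∧
      (∀ w ∈ closedBall (0 : X (k + 1)) (r (k + 1)),
        HasFDerivAt (fun w => Q k (Eq (σ w))) ((Q k).comp ((Eq' (σ w)).comp (fderiv ℝ σ w))) w) ∧
      (∀ w ∈ closedBall (0 : X (k + 1)) (r (k + 1)), ‖(Q k).comp ((Eq' (σ w)).comp (fderiv ℝ σ w))‖ ≤ B (k + 1)) ∧
      (∀ w ∈ closedBall (0 : X (k + 1)) (r (k + 1)), ∀ w' ∈ closedBall (0 : X (k + 1)) (r (k + 1)),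
        ‖(Q k).comp ((Eq' (σ w)).comp (fderiv ℝ σ w)) - (Q k).comp ((Eq' (σ w')).comp (fderiv ℝ σ w'))‖ ≤
          M (k + 1) * ‖w - w'‖) ∧
      (𝒬 (k + 1)).comp (𝒮.comp (fderiv ℝ σ 0)) = ContinuousLinearMap.id ℝ (X (k + 1)) ∧
      (∀ j, j < k + 1 → ∀ h, P j (𝒬 j (A₀ ((𝒮.comp (fderiv ℝ σ 0)) h))) = 0) ∧
      (Q k).comp ((Eq' (σ 0)).comp (fderiv ℝ σ 0)) = (𝒬 (k + 1)).comp (A₀.comp (𝒮.comp (fderiv ℝ σ 0))) := by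
  -- the chart at level `k` reads `(Q_k, P_k ∘ Eq′(0))` on the admissible section `𝒮`
  have hTk : ∀ h, T k h = (Q k h, P k ((Eq' 0) h)) := fun h => by
    rw [hT k 𝒮 h𝒮 hadm h, hlin]; rfl
  -- the smallness SIS consumes: modulus × radius
  have hck : ∀ x ∈ closedBall (0 : X k) (r k), ‖(P k).comp (Eq' x - Eq' 0)‖ ≤ c k := fun x hx =>
    (norm_comp_sub_le_of_modulus_closedBall (P k) (hCP k) (hM0 k) (hr0 k) hM hx).trans (hc k)
  -- SIS at level `k`
  obtain ⟨σ, hσ0, ha, hlip, huniq, hb, -, hc0, hcc, hcm, hd⟩ :=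
    SupInductiveStep.inductiveStep_eq (Q k) (Lp k) (P k) (ι k) (hPι k) (hCP k) hE0 (hr0 k) hE hB (hM0 k) hM
      (Eq' 0) (T k) hTk (hN k) (hcN k) hck
  -- the next radius sits inside the open chart ball, which is non-empty
  have hsub : closedBall (0 : X (k + 1)) (r (k + 1)) ⊆ ball (0 : X (k + 1)) (((N k : ℝ)⁻¹ - c k) * r k) :=
    closedBall_subset_ball (hr k)
  have h0ball : (0 : X (k + 1)) ∈ ball (0 : X (k + 1)) (((N k : ℝ)⁻¹ - c k) * r k) :=
    mem_ball_self (lt_of_le_of_lt (hr0 (k + 1)) (hr k))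
  obtain ⟨-, -, hQD, hPD⟩ := hb 0 h0ball
  refine ⟨σ, hσ0, ha, hlip, huniq, fun w hw => ?_, hd, hc0, fun w hw => (hcc w (hsub hw)).1,
    fun w hw => (hcc w (hsub hw)).2.trans (hBs k),
    fun w hw w' hw' => (hcm w (hsub hw) w' (hsub hw')).trans (mul_le_mul_of_nonneg_right (hMs k) (norm_nonneg _)),
    ?_, ?_, ?_⟩
  · obtain ⟨h1, h2, h3, -⟩ := hb w hw
    exact ⟨h1, h2, h3⟩
  · -- the next section: `𝒬_{k+1} ∘ 𝒮 ∘ Dσ(0) = Q_k ∘ (𝒬_k ∘ 𝒮) ∘ Dσ(0) = Q_k ∘ Dσ(0) = 1`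
    ext v
    rw [h𝒬 k]
    simp only [ContinuousLinearMap.comp_apply, ContinuousLinearMap.id_apply]
    exact comp_section_apply (𝒬 k) 𝒮 (Q k) (fderiv ℝ σ 0) h𝒮 hQD v
  · -- admissibility at every `j < k + 1`: below `k` by the state, at `k` by SIS (b) at `w = 0`
    intro j hj h
    rcases Nat.lt_succ_iff_lt_or_eq.1 hj with hj' | rfl
    · exact hadm j hj' (fderiv ℝ σ 0 h)
    · have e : Eq' 0 (fderiv ℝ σ 0 h) = 𝒬 j (A₀ (𝒮 (fderiv ℝ σ 0 h))) := by rw [hlin]; rfl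
      have h0 := hPD h
      rw [hσ0, e] at h0
      simpa only [ContinuousLinearMap.comp_apply] using h0
  · -- the next linearisation at the origin is the transported one
    rw [hσ0, hlin, h𝒬 k]
    ext v
    rfl

/-! ## §3. Toy -/

/-- Toy: at level `0` (`𝒬_0 = 1`) the only admissible section is `𝒮 = 1`, so the level-`0` chart hypothesis reads `T_0 h = (Q_0 h, P_0(A₀ h))`. -/
example (𝒮 : ℝ →L[ℝ] ℝ) (h : (ContinuousLinearMap.id ℝ ℝ).comp 𝒮 = ContinuousLinearMap.id ℝ ℝ) : 𝒮 = ContinuousLinearMap.id ℝ ℝ := by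
  simpa using h

end Summit.QuantumFields.BalabanUV.T4Continuum.NE7b.SupEquationTowerStep

end
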